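import Summits.QuantumFields.BalabanUV.T4Continuum.Support.NE7ApeOfTorusRoadV4
import Summits.QuantumFields.BalabanUV.T4Continuum.Support.NE7CornerCostFar
import Summits.QuantumFields.BalabanUV.T4Continuum.Support.NE3QuadRemainderLocality
import Literature.MathematicalPhysics.QuantumFieldTheory.Balaban1983to89.B13ReadingTransportY
import Literature.MathematicalPhysics.QuantumFieldTheory.Balaban1983to89.B13SiteReadingNumerals
import Literature.MathematicalPhysics.QuantumFieldTheory.Balaban1983to89.B6Cov2110WeightV1
import HarnessLib

/-!
# NE7TorusRoadGeometry — SITE∕BLOCK TORUS-DISTANCE BOOKKEEPING FOR THE TORUS ROAD'S INSTANTIATION: the fine torus distance `|x − z|_{T(MN)}` of two sites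
# and the coarse torus distance `|⌊x∕M⌋ − ⌊z∕M⌋|_{T(N)}` of their blocks differ by at most `M − 1` after scaling by `M`; the block of `z` read through
# `rep ∘ blockOf ∘ toT` is `⌊(z mod MN)∕M⌋`; the dependency radius `depRad d L (k+1)` is at most `nbRad·L^{k+1}`

Cell `pub-balaban`, rung (B)+1 sub-cell t4, lineage `b2b-balaban-t4-ne7-p1` (CRUX PROVER NE7 #1 = OWNER of row NE7), generation 90; memo
`t4/b2b-balaban-t4-ne7-p1-g90/DEFECT-FAR.md` §4 (instantiation I1b).  File F277 (over lit-balaban's `B13ReadingTransportY.circAbs_sub_le_mul_circAbs_ediv`,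
`B13SiteReadingNumerals.mul_circAbs_ediv_sub_ediv_le`, `B4TorusKernel.MultiPeriod.torusSupNorm_translate`, `B6Cov2110WeightV1.torusSupNorm_sub_le`, F254b
`NE7CornerCostFar.rep_blockOf_toT`, row NE3's `NE3QuadRemainderLocality.depRad`).

WHY (memo §4).  The v4 END F263 `NE7ApeOfTorusRoadV4.hape_of_torusRoadV4` phrases its near∕far regions through the COARSE torus distance
`torusSupNorm (fun _ => N) (⌊x∕M⌋ − rep(blockOf(toT z)))` of blocks, while the cut-off representative `χ•Ã` (F275∕F276) and the chart live at SITE scale around `z`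
with the fine torus distance of period `MN`.  Every geometric side condition of the instantiation (the variation zone of `χ` lies in the far set with its
neighbours; the near region and F259's dependency balls lie in the plateau; level slabs are `χ`-constant or far; agreement radii) reduces to the two-sided
comparison of this file plus the triangle inequality.
WHAT ([folklore] integer bookkeeping; 0 def, 0 sorry; dimension `d + 1`).
§1 **`depRad_add_nbRad_le`**, **`depRad_succ_le`** — `depRad d L k + nbRad ≤ nbRad·L^k` (`L ≥ 2`), hence `depRad d L (k+1) ≤ nbRad·L^{k+1}`.
§2 **`tsn_fine_le`** — `|x − z|_{T(MN)} ≤ M·|⌊x∕M⌋ − ⌊z∕M⌋|_{T(N)} + (M − 1)`; **`mul_tsn_block_le`** — `M·|⌊x∕M⌋ − ⌊z∕M⌋|_{T(N)} ≤ |x − z|_{T(MN)} + (M − 1)`.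
§3 **`rep_blockOf_toT_eq`** — `rep (blockOf (toT z)) = ⌊(z mod MN)∕M⌋` for EVERY `z`; **`tsn_fine_emod`** — `|x − (z mod MN)|_{T(MN)} = |x − z|_{T(MN)}`.
§4 **`tsn_fine_le_of_block_le`**, **`le_tsn_block_of_le_fine`** — the two comparisons read against `rep (blockOf (toT z))`:
   `|⌊x∕M⌋ − rep(blockOf(toT z))|_{T(N)} ≤ q ⇒ |x − z|_{T(MN)} ≤ qM + M − 1` and `qM + M − 1 ≤ |x − z|_{T(MN)} ⇒ q ≤ |⌊x∕M⌋ − rep(blockOf(toT z))|_{T(N)}`.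
§5 **`tsn_fine_le_add_supNorm`**, `tsn_fine_add_e_le`, `le_tsn_fine_add_e` — `|x − z|_T ≤ |x′ − z|_T + ‖x − x′‖_∞`; one lattice step moves `|· − z|_T` by at most `1`.
HONEST FRAMING (page 1): elementary bookkeeping; nothing of Bałaban's asserted; NOT (APE), NOT ONE-STEP, NOT NE7; spine 0∕9; finite T⁴ rung (B)+1 — NOT infinite volume,
NOT mass gap, NOT `BetaPertH`, NOT Clay.  Continuum YM on T⁴ ⇐ BetaPertH ∧ nine spine estimates (0/9 proved); BetaPertH ⇐ (D1) ∧ (D4) ∧ CAP+tail; G-an2-4 gates asym,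
D1 and NE2/3/4.
-/

set_option autoImplicit false

open scoped BigOperators
open Finset

namespace Summit.QuantumFields.BalabanUV.T4Continuum.NE7TorusRoadGeometry

open Literature.MathematicalPhysics.QuantumFieldTheory.Balaban1983to89
open B7Prop1Explicit
open B4ContourShift (supNorm abs_le_supNorm)
open B4TorusKernel.MultiPeriod (circAbs torusSupNorm translate torusSupNorm_translate circAbs_le_abs circAbs_nonneg torusSupNorm_le_supNorm)
open B13ReadingTransportY (circAbs_sub_le_mul_circAbs_ediv)
open B13SiteReadingNumerals (mul_circAbs_ediv_sub_ediv_le)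
open T4AveragingDeficitWallBoundary (periodBox mem_periodBox)
open B5Prop11Plancherel (Tor fine)
open B5Blocks16 (blockOf)
open B6LowerBound2153Torus (toT rep)
open BlockAverageVaryHolo (nbRad)
open NE3QuadRemainderLocality (depRad)
open NE7CornerCostFar (rep_blockOf_toT)

noncomputable section

variable {d : ℕ}

/-! ## §1 The dependency radius is at most `nbRad·L^{k+1}` -/

/-- `depRad d L k + nbRad d L ≤ nbRad d L · L^k` for `L ≥ 2` (the geometric sum `nbRad·(1 + L + ⋯ + L^{k−1})` plus one more `nbRad`). [folklore] -/
theorem depRad_add_nbRad_le {L : ℕ} (hL : 2 ≤ L) : ∀ k : ℕ, depRad d L k + nbRad d L ≤ nbRad d L * L ^ k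
  | 0 => by simp [depRad]
  | k + 1 => by
      have ih := depRad_add_nbRad_le hL k
      have h1 : L * (depRad d L k + nbRad d L) ≤ L * (nbRad d L * L ^ k) := Nat.mul_le_mul_left _ ih
      have h2 : 2 * nbRad d L ≤ L * nbRad d L := Nat.mul_le_mul_right _ hL
      show L * depRad d L k + nbRad d L + nbRad d L ≤ nbRad d L * L ^ (k + 1)
      rw [pow_succ]
      nlinarith [h1, h2]

/-- **`depRad d L (k+1) ≤ nbRad d L · L^{k+1}`** for `L ≥ 2`. [folklore] -/
theorem depRad_succ_le {L : ℕ} (hL : 2 ≤ L) (k : ℕ) : depRad d L (k + 1) ≤ nbRad d L * L ^ (k + 1) :=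
  le_trans (Nat.le_add_right _ _) (depRad_add_nbRad_le hL (k + 1))

/-! ## §2 Fine versus coarse torus distance -/

/-- **`|x − z|_{T(MN)} ≤ M·|⌊x∕M⌋ − ⌊z∕M⌋|_{T(N)} + (M − 1)`** (coordinatewise lit-balaban's `circAbs_sub_le_mul_circAbs_ediv`). [folklore] -/
theorem tsn_fine_le {M N : ℕ} (hM : 1 ≤ M) (hN : 1 ≤ N) (x z : Site (d + 1)) :
    torusSupNorm (fun _ : Fin (d + 1) => M * N) (x - z)
      ≤ (M : ℝ) * torusSupNorm (fun _ : Fin (d + 1) => N) (fun i => x i / (M : ℤ) - z i / (M : ℤ)) + ((M : ℝ) - 1) := by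
  have hM0 : (0 : ℝ) ≤ M := by positivity
  unfold torusSupNorm
  refine Finset.sup'_le _ _ fun i _ => ?_
  dsimp only
  have h := circAbs_sub_le_mul_circAbs_ediv M N hM hN (x i) (z i)
  have h' : ((circAbs (M * N) (x i - z i) : ℤ) : ℝ) ≤ (M : ℝ) * ((circAbs N (x i / (M : ℤ) - z i / (M : ℤ)) : ℤ) : ℝ) + ((M : ℝ) - 1) := by
    have := (Int.cast_le (R := ℝ)).mpr h
    push_cast at this
    linarith
  have hle : ((circAbs N (x i / (M : ℤ) - z i / (M : ℤ)) : ℤ) : ℝ)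
      ≤ Finset.univ.sup' Finset.univ_nonempty
          (fun j => ((circAbs ((fun _ : Fin (d + 1) => N) j) ((fun i => x i / (M : ℤ) - z i / (M : ℤ)) j) : ℤ) : ℝ)) :=
    Finset.le_sup' (fun j => ((circAbs ((fun _ : Fin (d + 1) => N) j) ((fun i => x i / (M : ℤ) - z i / (M : ℤ)) j) : ℤ) : ℝ))
      (Finset.mem_univ i)
  have hmul := mul_le_mul_of_nonneg_left hle hM0
  rw [Pi.sub_apply]
  linarith

/-- **`M·|⌊x∕M⌋ − ⌊z∕M⌋|_{T(N)} ≤ |x − z|_{T(MN)} + (M − 1)`** (coordinatewise lit-balaban's `mul_circAbs_ediv_sub_ediv_le`). [folklore] -/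
theorem mul_tsn_block_le {M N : ℕ} (hM : 1 ≤ M) (hN : 1 ≤ N) (x z : Site (d + 1)) :
    (M : ℝ) * torusSupNorm (fun _ : Fin (d + 1) => N) (fun i => x i / (M : ℤ) - z i / (M : ℤ))
      ≤ torusSupNorm (fun _ : Fin (d + 1) => M * N) (x - z) + ((M : ℝ) - 1) := by
  obtain ⟨i, -, hi⟩ := Finset.exists_mem_eq_sup' Finset.univ_nonempty
    (fun j => ((circAbs ((fun _ : Fin (d + 1) => N) j) ((fun i => x i / (M : ℤ) - z i / (M : ℤ)) j) : ℤ) : ℝ))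
  unfold torusSupNorm
  rw [hi]
  have h := mul_circAbs_ediv_sub_ediv_le hM hN (x i) (z i)
  have h' : (M : ℝ) * ((circAbs N (x i / (M : ℤ) - z i / (M : ℤ)) : ℤ) : ℝ) ≤ ((circAbs (M * N) (x i - z i) : ℤ) : ℝ) + ((M : ℝ) - 1) := by
    have := (Int.cast_le (R := ℝ)).mpr h
    push_cast at this
    linarith
  have hle : ((circAbs (M * N) (x i - z i) : ℤ) : ℝ)
      ≤ Finset.univ.sup' Finset.univ_nonempty (fun j => ((circAbs ((fun _ : Fin (d + 1) => M * N) j) ((x - z) j) : ℤ) : ℝ)) := by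
    have := Finset.le_sup' (fun j => ((circAbs ((fun _ : Fin (d + 1) => M * N) j) ((x - z) j) : ℤ) : ℝ)) (Finset.mem_univ i)
    simpa only [Pi.sub_apply] using this
  dsimp only
  linarith

/-! ## §3 The block of an arbitrary site, read on the torus -/

/-- **`rep (blockOf (toT z)) = ⌊(z mod MN)∕M⌋`** for EVERY site `z` (F254b `rep_blockOf_toT` after reducing `z` into the period box). [folklore] -/
theorem rep_blockOf_toT_eq (M N : ℕ) [NeZero M] [NeZero N] (z : Site (d + 1)) :
    rep (fun _ : Fin (d + 1) => N) (blockOf M (fun _ : Fin (d + 1) => N) (toT (fine M (fun _ : Fin (d + 1) => N)) z))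
      = fun i => (z i % ((M * N : ℕ) : ℤ)) / (M : ℤ) := by
  have hMN : NeZero (M * N) := ⟨Nat.mul_ne_zero (NeZero.ne M) (NeZero.ne N)⟩
  have hP : (0 : ℤ) < ((M * N : ℕ) : ℤ) := by exact_mod_cast Nat.pos_of_ne_zero (NeZero.ne (M * N))
  set z' : Site (d + 1) := fun i => z i % ((M * N : ℕ) : ℤ) with hz'
  have htoT : toT (fine M (fun _ : Fin (d + 1) => N)) z = toT (fine M (fun _ : Fin (d + 1) => N)) z' := by
    funext i
    show ((z i : ℤ) : ZMod (M * N)) = ((z i % ((M * N : ℕ) : ℤ) : ℤ) : ZMod (M * N))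
    rw [ZMod.intCast_mod]
  have hz'box : z' ∈ periodBox (d := d + 1) (M * N) :=
    mem_periodBox.mpr fun i => ⟨Int.emod_nonneg _ hP.ne', Int.emod_lt_of_pos _ hP⟩
  rw [htoT, rep_blockOf_toT M N z' hz'box]

/-- The fine torus distance is blind to the reduction `z ↦ z mod MN`. [folklore] -/
theorem tsn_fine_emod (M N : ℕ) [NeZero M] [NeZero N] (x z : Site (d + 1)) :
    torusSupNorm (fun _ : Fin (d + 1) => M * N) (x - fun i => z i % ((M * N : ℕ) : ℤ))
      = torusSupNorm (fun _ : Fin (d + 1) => M * N) (x - z) := by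
  have e1 : (x - fun i => z i % ((M * N : ℕ) : ℤ))
      = translate (fun _ : Fin (d + 1) => M * N) (x - z) (fun i => z i / ((M * N : ℕ) : ℤ)) := by
    funext i
    rw [B4TorusKernel.MultiPeriod.translate_apply, Pi.sub_apply, Pi.sub_apply]
    have h := Int.mul_ediv_add_emod (z i) ((M * N : ℕ) : ℤ)
    linarith
  rw [e1, torusSupNorm_translate]

/-! ## §4 The comparisons read against `rep (blockOf (toT z))` -/

/-- **NEAR BLOCKS ARE NEAR SITES**: `|⌊x∕M⌋ − rep(blockOf(toT z))|_{T(N)} ≤ q ⇒ |x − z|_{T(MN)} ≤ q·M + (M − 1)`. [folklore] -/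
theorem tsn_fine_le_of_block_le {M N : ℕ} [NeZero M] [NeZero N] (x z : Site (d + 1)) {q : ℝ}
    (h : torusSupNorm (fun _ : Fin (d + 1) => N) ((fun i => x i / (M : ℤ))
      - rep (fun _ : Fin (d + 1) => N) (blockOf M (fun _ : Fin (d + 1) => N) (toT (fine M (fun _ : Fin (d + 1) => N)) z))) ≤ q) :
    torusSupNorm (fun _ : Fin (d + 1) => M * N) (x - z) ≤ q * M + ((M : ℝ) - 1) := by
  have hM : 1 ≤ M := Nat.one_le_iff_ne_zero.mpr (NeZero.ne M)
  have hN : 1 ≤ N := Nat.one_le_iff_ne_zero.mpr (NeZero.ne N)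
  rw [rep_blockOf_toT_eq] at h
  rw [← tsn_fine_emod M N x z]
  have h1 := tsn_fine_le (d := d) hM hN x (fun i => z i % ((M * N : ℕ) : ℤ))
  have e : (fun i => x i / (M : ℤ) - (fun i => z i % ((M * N : ℕ) : ℤ)) i / (M : ℤ))
      = ((fun i => x i / (M : ℤ)) - fun i => z i % ((M * N : ℕ) : ℤ) / (M : ℤ)) := by
    funext i; simp
  rw [e] at h1
  have hM0 : (0 : ℝ) ≤ M := by positivity
  nlinarith [mul_le_mul_of_nonneg_left h hM0]

/-- **FAR SITES ARE FAR BLOCKS**: `q·M + (M − 1) ≤ |x − z|_{T(MN)} ⇒ q ≤ |⌊x∕M⌋ − rep(blockOf(toT z))|_{T(N)}`. [folklore] -/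
theorem le_tsn_block_of_le_fine {M N : ℕ} [NeZero M] [NeZero N] (x z : Site (d + 1)) {q : ℝ}
    (h : q * M + ((M : ℝ) - 1) ≤ torusSupNorm (fun _ : Fin (d + 1) => M * N) (x - z)) :
    q ≤ torusSupNorm (fun _ : Fin (d + 1) => N) ((fun i => x i / (M : ℤ))
      - rep (fun _ : Fin (d + 1) => N) (blockOf M (fun _ : Fin (d + 1) => N) (toT (fine M (fun _ : Fin (d + 1) => N)) z))) := by
  have hM : 1 ≤ M := Nat.one_le_iff_ne_zero.mpr (NeZero.ne M)
  have hN : 1 ≤ N := Nat.one_le_iff_ne_zero.mpr (NeZero.ne N)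
  rw [rep_blockOf_toT_eq]
  rw [← tsn_fine_emod M N x z] at h
  have h1 := tsn_fine_le (d := d) hM hN x (fun i => z i % ((M * N : ℕ) : ℤ))
  have e : (fun i => x i / (M : ℤ) - (fun i => z i % ((M * N : ℕ) : ℤ)) i / (M : ℤ))
      = ((fun i => x i / (M : ℤ)) - fun i => z i % ((M * N : ℕ) : ℤ) / (M : ℤ)) := by
    funext i; simp
  rw [e] at h1
  have hMpos : (0 : ℝ) < M := by exact_mod_cast (by omega : 0 < M)
  refine le_of_mul_le_mul_left ?_ hMpos
  linarith

/-! ## §5 The fine torus distance under bounded moves -/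

/-- `|x − z|_T ≤ |x′ − z|_T + ‖x − x′‖_∞`. [folklore] -/
theorem tsn_fine_le_add_supNorm (P : ℕ) [NeZero P] (x x' z : Site (d + 1)) :
    torusSupNorm (fun _ : Fin (d + 1) => P) (x - z) ≤ torusSupNorm (fun _ : Fin (d + 1) => P) (x' - z) + supNorm (x - x') := by
  have hP : ∀ i : Fin (d + 1), 1 ≤ (fun _ : Fin (d + 1) => P) i := fun _ => Nat.one_le_iff_ne_zero.mpr (NeZero.ne P)
  have h := B6Cov2110WeightV1.torusSupNorm_sub_le (fun _ : Fin (d + 1) => P) x x' z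
  have h2 := torusSupNorm_le_supNorm hP (x - x')
  linarith

/-- One lattice step: `|x + e_κ − z|_T ≤ |x − z|_T + 1`. [folklore] -/
theorem tsn_fine_add_e_le (P : ℕ) [NeZero P] (x z : Site (d + 1)) (κ : Fin (d + 1)) :
    torusSupNorm (fun _ : Fin (d + 1) => P) (x + e κ - z) ≤ torusSupNorm (fun _ : Fin (d + 1) => P) (x - z) + 1 := by
  have h := tsn_fine_le_add_supNorm P (x + e κ) x z
  have hs : supNorm (x + e κ - x) ≤ 1 := by
    rw [add_sub_cancel_left]
    unfold supNorm
    refine Finset.sup'_le _ _ fun i _ => ?_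
    rw [e_apply]
    split_ifs <;> simp
  linarith

/-- And back: `|x − z|_T ≤ |x + e_κ − z|_T + 1`. [folklore] -/
theorem le_tsn_fine_add_e (P : ℕ) [NeZero P] (x z : Site (d + 1)) (κ : Fin (d + 1)) :
    torusSupNorm (fun _ : Fin (d + 1) => P) (x - z) ≤ torusSupNorm (fun _ : Fin (d + 1) => P) (x + e κ - z) + 1 := by
  have h := tsn_fine_le_add_supNorm P x (x + e κ) z
  have hs : supNorm (x - (x + e κ)) ≤ 1 := by
    rw [sub_add_cancel_left]
    unfold supNorm
    refine Finset.sup'_le _ _ fun i _ => ?_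
    rw [Pi.neg_apply, abs_neg, e_apply]
    split_ifs <;> simp
  linarith

/-- `|x − z|_T ≤ |x′ − z|_T + (2M − 1)` for two sites of one level slab `{M w ≤ · ≤ M w + 2M − 1}` (coordinatewise). [folklore] -/
theorem tsn_fine_le_of_slab (P : ℕ) [NeZero P] {M : ℤ} (w x x' z : Site (d + 1))
    (hx : ∀ i, M * w i ≤ x i ∧ x i ≤ M * w i + 2 * M - 1) (hx' : ∀ i, M * w i ≤ x' i ∧ x' i ≤ M * w i + 2 * M - 1) :
    torusSupNorm (fun _ : Fin (d + 1) => P) (x - z) ≤ torusSupNorm (fun _ : Fin (d + 1) => P) (x' - z) + (2 * (M : ℝ) - 1) := by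
  have h := tsn_fine_le_add_supNorm P x x' z
  have hs : supNorm (x - x') ≤ 2 * (M : ℝ) - 1 := by
    unfold supNorm
    refine Finset.sup'_le _ _ fun i _ => ?_
    have h1 := hx i; have h2 := hx' i
    have : |(x - x') i| ≤ 2 * M - 1 := by rw [Pi.sub_apply, abs_le]; constructor <;> linarith
    exact_mod_cast this
  linarith

/-- `|x − z|_T ≤ ‖x − M•y‖_∞ + M·‖y − c‖_∞ + ‖M•c − z‖_∞`-type bound, in the form the dependency balls of F259 need: if `l1 (x − M•y) ≤ R₁`, `‖y − c‖_∞ ≤ R₂` and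
`0 ≤ z_i − M c_i ≤ M − 1` then `|x − z|_T ≤ R₁ + M·R₂ + (M − 1)`. [folklore] -/
theorem tsn_fine_le_of_l1_ball (P : ℕ) [NeZero P] {M : ℕ} (x y c z : Site (d + 1)) {R₁ R₂ : ℕ}
    (hx : l1 (x - (M : ℤ) • y) ≤ R₁) (hy : supNorm (y - c) ≤ R₂) (hz : ∀ i, 0 ≤ z i - (M : ℤ) * c i ∧ z i - (M : ℤ) * c i ≤ (M : ℤ) - 1) :
    torusSupNorm (fun _ : Fin (d + 1) => P) (x - z) ≤ (R₁ : ℝ) + (M : ℝ) * R₂ + ((M : ℝ) - 1) := by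
  have hP : ∀ i : Fin (d + 1), 1 ≤ (fun _ : Fin (d + 1) => P) i := fun _ => Nat.one_le_iff_ne_zero.mpr (NeZero.ne P)
  refine (torusSupNorm_le_supNorm hP (x - z)).trans ?_
  unfold supNorm
  refine Finset.sup'_le _ _ fun i _ => ?_
  -- coordinate `i`, in `ℤ`
  have hx' : ∑ κ, ((x - (M : ℤ) • y) κ).natAbs ≤ R₁ := hx
  have h1 : ((x - (M : ℤ) • y) i).natAbs ≤ R₁ :=
    le_trans (Finset.single_le_sum (f := fun κ => ((x - (M : ℤ) • y) κ).natAbs) (fun _ _ => Nat.zero_le _) (Finset.mem_univ i)) hx'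
  have h1' : |x i - (M : ℤ) * y i| ≤ R₁ := by
    have : (((x - (M : ℤ) • y) i).natAbs : ℤ) ≤ R₁ := by exact_mod_cast h1
    rw [Int.natCast_natAbs] at this
    simpa [Pi.sub_apply, Pi.smul_apply, smul_eq_mul] using this
  have h2 : |y i - c i| ≤ (R₂ : ℤ) := by
    have := (abs_le_supNorm (y - c) i).trans hy
    rw [Pi.sub_apply] at this
    exact_mod_cast this
  have h3 := hz i
  have hM0 : (0 : ℤ) ≤ M := by positivity
  have e1 : x i - z i = (x i - (M : ℤ) * y i) + (M : ℤ) * (y i - c i) - (z i - (M : ℤ) * c i) := by ring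
  have t1 : |x i - z i| ≤ |x i - (M : ℤ) * y i| + |(M : ℤ) * (y i - c i)| + |z i - (M : ℤ) * c i| := by
    rw [e1]
    have a1 := abs_sub ((x i - (M : ℤ) * y i) + (M : ℤ) * (y i - c i)) (z i - (M : ℤ) * c i)
    have a2 := abs_add_le (x i - (M : ℤ) * y i) ((M : ℤ) * (y i - c i))
    linarith
  have t2 : |(M : ℤ) * (y i - c i)| = (M : ℤ) * |y i - c i| := by rw [abs_mul, abs_of_nonneg hM0]
  have t3 : |z i - (M : ℤ) * c i| ≤ (M : ℤ) - 1 := abs_le.mpr ⟨by linarith [h3.1], h3.2⟩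
  have key : |x i - z i| ≤ (R₁ : ℤ) + (M : ℤ) * R₂ + ((M : ℤ) - 1) := by
    rw [t2] at t1
    nlinarith [mul_le_mul_of_nonneg_left h2 hM0]
  have key' := (Int.cast_le (R := ℝ)).mpr key
  push_cast at key'
  rw [Pi.sub_apply]
  push_cast
  exact key'

end

end Summit.QuantumFields.BalabanUV.T4Continuum.NE7TorusRoadGeometry
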